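import Mathlib
import Summits.Ventures.PercRepro2.IFRTail
import Summits.Ventures.PercRepro2.IFRConv
import Summits.Ventures.PercRepro2.IFRSP
import Summits.Ventures.PercRepro2.IFRFlowLaw

/-!
# The path-dual of row B2: the distance to the connection event of a random series–parallel network
has a log-concave tail (seat mine-b, cell pub-perc-repro2)

`IFRFlowLaw.lean` attaches the log-concave tail calculus to the **flow** (= packing number of the
connection event: edge ↦ state, series ↦ min, parallel ↦ sum).  The **distance to the connection
event**, `D(ω) = min` over terminal-to-terminal paths of the number of CLOSED edges on the path
(= the number of edges one has to open to connect the terminals; by the length–width duality also the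
maximal number of pairwise disjoint closed cuts), obeys the DUAL recursion on a series–parallel
network: edge ↦ `1 − state`, series ↦ sum, parallel ↦ min.  The same two closure lemmas of
`IFRSP.lean` (product of tails, convolution tail) therefore give log-concavity of `k ↦ P(D ≥ k)`:
`SP.probD_logconcave`.  On a planar network with the terminals on the outer face this is row B2 for
the dual network (`D` is the dual flow); for a general graph it is the PATH-DUAL twin of B2
(conjectures/MINE-B.md §8).  Also: `SP.dist_eq_zero_iff` (`D = 0 ⟺ F ≥ 1`) and
`SP.probD_one_add_prob_one` (`P(D ≥ 1) + P(F ≥ 1) = 1`).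
-/

open Finset

namespace Summit.Ventures.PercRepro2.IFR

/-- support bound of the distance tail -/
def SP.dbound : SP → ℤ
  | .edge _ _ _ => 2
  | .series a b => a.dbound + b.dbound
  | .parallel a b => min a.dbound b.dbound

/-- the distance bound is positive -/
theorem SP.dbound_pos : ∀ t : SP, 1 ≤ t.dbound
  | .edge _ _ _ => by simp [SP.dbound]
  | .series a b => by
      simp only [SP.dbound]; have := SP.dbound_pos a; have := SP.dbound_pos b; omega
  | .parallel a b => by
      simp only [SP.dbound]; have := SP.dbound_pos a; have := SP.dbound_pos b; omega

/-- the dual tail calculus: edge ↦ `edgeTail (1 − p)`, series ↦ `Hsum` (convolution), parallel ↦ product -/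
noncomputable def SP.dualTail : SP → (ℤ → ℝ)
  | .edge p _ _ => edgeTail (1 - p)
  | .series a b => Hsum a.dualTail b.dualTail (b.dbound + 1)
  | .parallel a b => fun k => a.dualTail k * b.dualTail k

/-- **the dual tail calculus is log-concave** -/
theorem SP.dualTail_isLCTail : ∀ t : SP, IsLCTail t.dualTail t.dbound
  | .edge p h0 h1 => edgeTail_isLCTail (by linarith) (by linarith)
  | .series a b => by
      simp only [SP.dualTail, SP.dbound]
      have hb := SP.dbound_pos b
      exact Hsum_isLCTail (SP.dualTail_isLCTail a) (SP.dualTail_isLCTail b) le_rfl (by omega)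
  | .parallel a b => by
      simp only [SP.dualTail, SP.dbound]
      exact mul_isLCTail (SP.dualTail_isLCTail a) (SP.dualTail_isLCTail b)

/-- the distance to the connection event: a closed edge costs 1, an open edge 0; series = sum,
parallel = minimum -/
def SP.dist : ∀ t : SP, t.Config → ℤ
  | .edge _ _ _ => fun (b : Bool) => if b then 0 else 1
  | .series a b => fun (ω : a.Config × b.Config) => a.dist ω.1 + b.dist ω.2
  | .parallel a b => fun (ω : a.Config × b.Config) => min (a.dist ω.1) (b.dist ω.2)

/-- `P(D ≥ k)` -/
noncomputable def SP.probD (t : SP) (k : ℤ) : ℝ :=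
  ∑ ω : t.Config, if k ≤ t.dist ω then t.weight ω else 0

/-- the distance is non-negative -/
theorem SP.dist_nonneg : ∀ (t : SP) (ω : t.Config), 0 ≤ t.dist ω
  | .edge _ _ _, b => by
      change Bool at b
      show (0 : ℤ) ≤ (if b then 0 else 1); split_ifs <;> norm_num
  | .series a b, ω => by
      show 0 ≤ a.dist ω.1 + b.dist ω.2
      exact add_nonneg (SP.dist_nonneg a ω.1) (SP.dist_nonneg b ω.2)
  | .parallel a b, ω => by
      show 0 ≤ min (a.dist ω.1) (b.dist ω.2)
      exact le_min (SP.dist_nonneg a ω.1) (SP.dist_nonneg b ω.2)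

/-- the distance is below the support bound -/
theorem SP.dist_lt_dbound : ∀ (t : SP) (ω : t.Config), t.dist ω < t.dbound
  | .edge _ _ _, b => by
      change Bool at b
      show (if b then (0:ℤ) else 1) < 2; split_ifs <;> norm_num
  | .series a b, ω => by
      show a.dist ω.1 + b.dist ω.2 < a.dbound + b.dbound
      exact add_lt_add (SP.dist_lt_dbound a ω.1) (SP.dist_lt_dbound b ω.2)
  | .parallel a b, ω => by
      show min (a.dist ω.1) (b.dist ω.2) < min a.dbound b.dbound
      have h1 := SP.dist_lt_dbound a ω.1; have h2 := SP.dist_lt_dbound b ω.2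
      exact lt_min (lt_of_le_of_lt (min_le_left _ _) h1) (lt_of_le_of_lt (min_le_right _ _) h2)

/-- `P(D = s)` as a difference of tails -/
theorem SP.probD_sub (t : SP) (s : ℤ) :
    t.probD s - t.probD (s + 1) = ∑ ω : t.Config, if t.dist ω = s then t.weight ω else 0 := by
  unfold SP.probD
  rw [← Finset.sum_sub_distrib]
  refine Finset.sum_congr rfl fun ω _ => ?_
  by_cases h : t.dist ω = s
  · subst h; simp
  · by_cases h2 : s ≤ t.dist ω
    · have h3 : s + 1 ≤ t.dist ω := by omega
      simp [h2, h3, h]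
    · have h3 : ¬ s + 1 ≤ t.dist ω := by omega
      simp [h2, h3, h]

/-- the law of the distance is given by the dual tail calculus: `P(D ≥ k) = SP.dualTail k` -/
theorem SP.probD_eq_dualTail : ∀ (t : SP) (k : ℤ), t.probD k = t.dualTail k
  | .edge p h0 h1, k => by
      unfold SP.probD
      show (∑ b : Bool, if k ≤ (if b then (0:ℤ) else 1) then (if b then p else 1 - p) else 0)
          = edgeTail (1 - p) k
      rw [Fintype.sum_bool]
      unfold edgeTail
      by_cases hk0 : k ≤ 0
      · have hk1 : k ≤ 1 := by omega
        simp [hk0, hk1]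
      · by_cases hk1 : k = 1
        · subst hk1; simp
        · have hk2 : ¬ k ≤ 1 := by omega
          simp [hk0, hk1, hk2]
  | .parallel a b, k => by
      unfold SP.probD
      show (∑ ω : a.Config × b.Config, if k ≤ min (a.dist ω.1) (b.dist ω.2) then a.weight ω.1 * b.weight ω.2 else 0)
          = a.dualTail k * b.dualTail k
      rw [← SP.probD_eq_dualTail a k, ← SP.probD_eq_dualTail b k]
      unfold SP.probD
      rw [Finset.sum_mul_sum, ← Finset.univ_product_univ, Finset.sum_product]
      refine Finset.sum_congr rfl fun x _ => Finset.sum_congr rfl fun y _ => ?_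
      by_cases h1 : k ≤ a.dist x <;> by_cases h2 : k ≤ b.dist y <;> simp [h1, h2]
  | .series a b, k => by
      unfold SP.probD
      show (∑ ω : a.Config × b.Config, if k ≤ a.dist ω.1 + b.dist ω.2 then a.weight ω.1 * b.weight ω.2 else 0)
          = Hsum a.dualTail b.dualTail (b.dbound + 1) k
      unfold Hsum
      rw [← Finset.univ_product_univ, Finset.sum_product_right]
      have hin : ∀ y : b.Config, (∑ x : a.Config, if k ≤ a.dist x + b.dist y then a.weight x * b.weight y else 0)
          = b.weight y * a.dualTail (k - b.dist y) := by
        intro y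
        rw [← SP.probD_eq_dualTail a, SP.probD, Finset.mul_sum]
        refine Finset.sum_congr rfl fun x _ => ?_
        by_cases h : k ≤ a.dist x + b.dist y
        · have h' : k - b.dist y ≤ a.dist x := by omega
          simp [h, h']; ring
        · have h' : ¬ k - b.dist y ≤ a.dist x := by omega
          simp [h, h']
      simp_rw [hin]
      have hmaps : ∀ y ∈ (Finset.univ : Finset b.Config), b.dist y ∈ I (b.dbound + 1) := by
        intro y _
        unfold I
        have h1 := SP.dist_nonneg b y; have h2 := SP.dist_lt_dbound b y
        simp only [Finset.mem_Icc]; omega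
      rw [← Finset.sum_fiberwise_of_maps_to hmaps]
      refine Finset.sum_congr rfl fun s _ => ?_
      have h1 : (∑ i ∈ Finset.filter (fun i => b.dist i = s) Finset.univ, b.weight i * a.dualTail (k - b.dist i))
          = (∑ i ∈ Finset.filter (fun i => b.dist i = s) Finset.univ, b.weight i) * a.dualTail (k - s) := by
        rw [Finset.sum_mul]
        refine Finset.sum_congr rfl fun y hy => ?_
        rw [Finset.mem_filter] at hy
        rw [hy.2]
      rw [h1, Finset.sum_filter, ← SP.probD_sub b s, SP.probD_eq_dualTail b, SP.probD_eq_dualTail b]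
      rfl

/-- **Log-concavity of the distance tail of a random series–parallel network** (the path-dual of row B2,
series–parallel case, for the random variable itself): `P(D ≥ k−1)·P(D ≥ k+1) ≤ P(D ≥ k)²`. -/
theorem SP.probD_logconcave (t : SP) (k : ℤ) :
    t.probD (k - 1) * t.probD (k + 1) ≤ t.probD k * t.probD k := by
  rw [SP.probD_eq_dualTail, SP.probD_eq_dualTail, SP.probD_eq_dualTail]
  exact (SP.dualTail_isLCTail t).lc k

/-- the distance vanishes exactly when the flow is positive: `D = 0 ⟺ F ≥ 1` (the terminals are connected) -/
theorem SP.dist_eq_zero_iff : ∀ (t : SP) (ω : t.Config), t.dist ω = 0 ↔ 1 ≤ t.flow ω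
  | .edge _ _ _, b => by
      change Bool at b
      show (if b then (0:ℤ) else 1) = 0 ↔ 1 ≤ (if b then (1:ℤ) else 0)
      cases b <;> simp
  | .series a b, ω => by
      show a.dist ω.1 + b.dist ω.2 = 0 ↔ 1 ≤ min (a.flow ω.1) (b.flow ω.2)
      have ha := SP.dist_eq_zero_iff a ω.1; have hb := SP.dist_eq_zero_iff b ω.2
      have h1 := SP.dist_nonneg a ω.1; have h2 := SP.dist_nonneg b ω.2
      rw [le_min_iff, ← ha, ← hb]; omega
  | .parallel a b, ω => by
      show min (a.dist ω.1) (b.dist ω.2) = 0 ↔ 1 ≤ a.flow ω.1 + b.flow ω.2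
      have ha := SP.dist_eq_zero_iff a ω.1; have hb := SP.dist_eq_zero_iff b ω.2
      have h1 := SP.dist_nonneg a ω.1; have h2 := SP.dist_nonneg b ω.2
      have f1 := SP.flow_nonneg a ω.1; have f2 := SP.flow_nonneg b ω.2
      constructor
      · intro h
        rcases le_total (a.dist ω.1) (b.dist ω.2) with hle | hle
        · rw [min_eq_left hle] at h; have := ha.1 h; omega
        · rw [min_eq_right hle] at h; have := hb.1 h; omega
      · intro h
        by_cases hf : 1 ≤ a.flow ω.1
        · have := ha.2 hf; rw [this]; exact min_eq_left_iff.mpr h2 |>.symm ▸ (by omega : min 0 (b.dist ω.2) = 0)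
        · have hf2 : 1 ≤ b.flow ω.2 := by omega
          have := hb.2 hf2; rw [this]; omega

/-- `P(D ≥ 1) + P(F ≥ 1) = 1`: the terminals are disconnected exactly when the distance is positive -/
theorem SP.probD_one_add_prob_one (t : SP) : t.probD 1 + t.prob 1 = 1 := by
  rw [← SP.sum_weight t]
  unfold SP.probD SP.prob
  rw [← Finset.sum_add_distrib]
  refine Finset.sum_congr rfl fun ω _ => ?_
  have hd := SP.dist_nonneg t ω
  have hiff := SP.dist_eq_zero_iff t ω
  by_cases h : 1 ≤ t.flow ω
  · have h0 : t.dist ω = 0 := hiff.2 h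
    have : ¬ (1 ≤ t.dist ω) := by omega
    simp [h, this]
  · have h0 : t.dist ω ≠ 0 := fun h0 => h (hiff.1 h0)
    have : 1 ≤ t.dist ω := by omega
    simp [h, this]

end Summit.Ventures.PercRepro2.IFR
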